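import Mathlib
import Summits.Ventures.PercRepro.TriangleCapFourthBest
import Summits.Ventures.PercRepro.TriangleCapMaxDegStability3

/-!
# PercRepro — THE NEAR-STAR FORMULA AND THE FOURTH-BEST LOCUS OF THE `K₄⁻`-FREE CHERRY TABLE (p3, gen 50; part 212)

THE NEAR-STAR DEGREES (`deg_eq_of_two_off`): if every edge of `H` not containing `w` is one of two edges `e ≠ f`
(so `d(w) = s − 2`), then every vertex `v ≠ w` has degree `[w ~ v] + [v ∈ e] + [v ∈ f]` — its incidence set is the
disjoint union of `{s(v, w)}` (if `w ~ v`), `{e}` (if `v ∈ e`) and `{f}` (if `v ∈ f`).  Squaring and summing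
(`sum_deg_sq_two_off`):

  `Σ_v d(v)² = d(w)² + d(w) + 4 + 2 (|N(w) ∩ e| + |N(w) ∩ f| + |e ∩ f|)`.

In a triangle-free graph each of the three counts is `≤ 1` (`card_adj_mem_le_one`: both ends of `e` adjacent to `w`
would close a triangle; `card_mem_mem_le_one`: two common vertices force `e = f`), so `Σ_v d(v)² ≤ s (s + 1) − 4 (s − 3)`
with equality iff all three are `1`: `e` and `f` share a vertex and each meets `N(w)` — the DOUBLE BROOM (the shared
vertex is the leaf `u ∈ N(w)`) or the `4`-CYCLE-WITH-A-STAR (the shared vertex `x ∉ N(w)` is joined to two leaves).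

THE FOURTH-BEST LOCUS OF THE PAIR COUNT (`fourth_locus_of_sum_deg_sq`, `s ≥ 8`): a triangle-free graph with
`Σ_v d(v)² + 4 (s − 3) = s (s + 1)` has a vertex `w` of degree `s − 2` with exactly that structure (the max-degree
trichotomy: `Δ ≤ s − 3` is the level-two stability `Σ d² + 6 (s − 4) ≤ s (s + 1)`, too low for `s ≥ 7`; `Δ ≥ s − 1`
gives the three top values, none of which is the fourth for `s ≥ 6`).  On the cell (`cherry_fourth_best_locus`):
when `4 (r − 3) < stabGapFull k a r` (so the fourth value is bipartite) every `K₄⁻`-free graph at `closed − 4 (r − 3)`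
is `a`-bipartite with its missing pairs an `(r − 2)`-star at `w` plus two pairs sharing a vertex, each meeting the
star's leaves.  The converse (`sum_deg_sq_of_fourth_locus`) is the formula read backwards.

Axioms: standard.
-/

namespace PercRepro

namespace TriangleCap

namespace C047

open Finset

variable {V : Type*} [Fintype V] [DecidableEq V]

/-- The degree is the number of edges containing the vertex. -/
theorem deg_eq_card_filter_mem (H : SimpleGraph V) [DecidableRel H.Adj] (v : V) :
    deg H v = (H.edgeFinset.filter (fun g => v ∈ g)).card := by
  rw [deg_eq_degree, ← SimpleGraph.card_incidenceFinset_eq_degree, SimpleGraph.incidenceFinset_eq_filter]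

/-- **THE NEAR-STAR DEGREES:** if every edge not containing `w` is `e` or `f` (`e ≠ f`, both off `w`), then for
`v ≠ w`: `d(v) = [w ~ v] + [v ∈ e] + [v ∈ f]`. -/
theorem deg_eq_of_two_off (H : SimpleGraph V) [DecidableRel H.Adj] (w : V) (e f : Sym2 V)
    (he : e ∈ H.edgeFinset) (hf : f ∈ H.edgeFinset) (hwe : w ∉ e) (hwf : w ∉ f) (hef : e ≠ f)
    (hall : ∀ g ∈ H.edgeFinset, w ∈ g ∨ g = e ∨ g = f) (v : V) (hvw : v ≠ w) :
    deg H v = (if H.Adj w v then 1 else 0) + (if v ∈ e then 1 else 0) + (if v ∈ f then 1 else 0) := by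
  rw [deg_eq_card_filter_mem]
  have key : H.edgeFinset.filter (fun g => v ∈ g) =
      (if H.Adj w v then {s(v, w)} else ∅) ∪ ((if v ∈ e then {e} else ∅) ∪ (if v ∈ f then {f} else ∅)) := by
    ext g
    simp only [mem_filter, mem_union]
    constructor
    · rintro ⟨hg, hvg⟩
      rcases hall g hg with hwg | rfl | rfl
      · left
        have hg' : g = s(v, w) := (Sym2.mem_and_mem_iff hvw).mp ⟨hvg, hwg⟩
        have hadj : H.Adj v w := by
          rw [hg'] at hg
          exact (SimpleGraph.mem_edgeSet H).mp (SimpleGraph.mem_edgeFinset.mp hg)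
        rw [if_pos hadj.symm, mem_singleton]
        exact hg'
      · right; left
        rw [if_pos hvg]
        exact mem_singleton_self _
      · right; right
        rw [if_pos hvg]
        exact mem_singleton_self _
    · rintro (h | h | h)
      · split_ifs at h with hadj
        · rw [mem_singleton] at h
          subst h
          exact ⟨SimpleGraph.mem_edgeFinset.mpr ((SimpleGraph.mem_edgeSet H).mpr hadj.symm),
            Sym2.mem_mk_left v w⟩
        · exact absurd h (Finset.notMem_empty _)
      · split_ifs at h with hve
        · rw [mem_singleton] at h
          subst h
          exact ⟨he, hve⟩
        · exact absurd h (Finset.notMem_empty _)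
      · split_ifs at h with hvf
        · rw [mem_singleton] at h
          subst h
          exact ⟨hf, hvf⟩
        · exact absurd h (Finset.notMem_empty _)
  have hd1 : Disjoint (if v ∈ e then ({e} : Finset (Sym2 V)) else ∅) (if v ∈ f then {f} else ∅) := by
    split_ifs
    · exact Finset.disjoint_singleton.mpr hef
    · exact Finset.disjoint_empty_right _
    · exact Finset.disjoint_empty_left _
    · exact Finset.disjoint_empty_left _
  have hd2 : Disjoint (if H.Adj w v then ({s(v, w)} : Finset (Sym2 V)) else ∅)
      ((if v ∈ e then {e} else ∅) ∪ (if v ∈ f then {f} else ∅)) := by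
    rw [disjoint_left]
    intro g hg hg'
    split_ifs at hg with hadj
    · rw [mem_singleton] at hg
      subst hg
      rw [mem_union] at hg'
      rcases hg' with h | h
      · split_ifs at h with hve
        · rw [mem_singleton] at h
          exact hwe (h ▸ Sym2.mem_mk_right v w)
        · exact absurd h (Finset.notMem_empty _)
      · split_ifs at h with hvf
        · rw [mem_singleton] at h
          exact hwf (h ▸ Sym2.mem_mk_right v w)
        · exact absurd h (Finset.notMem_empty _)
    · exact absurd hg (Finset.notMem_empty _)
  rw [key, card_union_of_disjoint hd2, card_union_of_disjoint hd1, apply_ite Finset.card, apply_ite Finset.card,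
    apply_ite Finset.card, card_singleton, card_singleton, card_singleton, card_empty]
  ring

/-- The pointwise expansion of a sum of three `0/1` indicators squared. -/
theorem three_indicator_sq (a b c : ℕ) (ha : a ≤ 1) (hb : b ≤ 1) (hc : c ≤ 1) :
    (a + b + c) * (a + b + c) = a + b + c + 2 * (a * b + a * c + b * c) := by
  interval_cases a <;> interval_cases b <;> interval_cases c <;> norm_num

/-- `Σ_{v ≠ w} [w ~ v] = d(w)`. -/
theorem sum_erase_boole_adj (H : SimpleGraph V) [DecidableRel H.Adj] (w : V) :
    ∑ v ∈ (univ : Finset V).erase w, (if H.Adj w v then 1 else 0) = deg H w := by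
  rw [sum_boole, Nat.cast_id, filter_erase, erase_eq_of_notMem]
  · rfl
  · intro h
    exact H.irrefl (mem_filter.mp h).2

/-- `Σ_{v ≠ w} [v ∈ e] = 2` for an edge `e` not containing `w`. -/
theorem sum_erase_boole_mem (H : SimpleGraph V) [DecidableRel H.Adj] (w : V) (e : Sym2 V) (he : e ∈ H.edgeFinset)
    (hwe : w ∉ e) : ∑ v ∈ (univ : Finset V).erase w, (if v ∈ e then 1 else 0) = 2 := by
  rw [sum_boole, Nat.cast_id, filter_erase, erase_eq_of_notMem (fun h => hwe (mem_filter.mp h).2)]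
  induction e using Sym2.ind with
  | h x y =>
    have hxy : x ≠ y := by
      intro h
      exact SimpleGraph.not_isDiag_of_mem_edgeSet H (SimpleGraph.mem_edgeFinset.mp he) (Sym2.mk_isDiag_iff.mpr h)
    have : (univ.filter (fun v : V => v ∈ s(x, y))) = {x, y} := by
      ext v
      simp only [mem_filter, mem_univ, true_and, Sym2.mem_iff, mem_insert, mem_singleton]
    rw [this, card_pair hxy]

/-- `Σ_{v ≠ w} [w ~ v ∧ v ∈ e] = |N(w) ∩ e|`. -/
theorem sum_erase_boole_adj_mem (H : SimpleGraph V) [DecidableRel H.Adj] (w : V) (e : Sym2 V) :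
    ∑ v ∈ (univ : Finset V).erase w, (if H.Adj w v ∧ v ∈ e then 1 else 0) =
      (univ.filter (fun v => H.Adj w v ∧ v ∈ e)).card := by
  rw [sum_boole, Nat.cast_id, filter_erase, erase_eq_of_notMem]
  intro h
  exact H.irrefl (mem_filter.mp h).2.1

/-- `Σ_{v ≠ w} [v ∈ e ∧ v ∈ f] = |e ∩ f|` for `w ∉ e`. -/
theorem sum_erase_boole_mem_mem (w : V) (e f : Sym2 V) (hwe : w ∉ e) :
    ∑ v ∈ (univ : Finset V).erase w, (if v ∈ e ∧ v ∈ f then 1 else 0) =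
      (univ.filter (fun v => v ∈ e ∧ v ∈ f)).card := by
  rw [sum_boole, Nat.cast_id, filter_erase, erase_eq_of_notMem]
  intro h
  exact hwe (mem_filter.mp h).2.1

/-- **THE NEAR-STAR FORMULA:** if every edge not containing `w` is `e` or `f` (`e ≠ f`, both off `w`), then
`Σ_v d(v)² = d(w)² + d(w) + 4 + 2 (|N(w) ∩ e| + |N(w) ∩ f| + |e ∩ f|)`. -/
theorem sum_deg_sq_two_off (H : SimpleGraph V) [DecidableRel H.Adj] (w : V) (e f : Sym2 V)
    (he : e ∈ H.edgeFinset) (hf : f ∈ H.edgeFinset) (hwe : w ∉ e) (hwf : w ∉ f) (hef : e ≠ f)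
    (hall : ∀ g ∈ H.edgeFinset, w ∈ g ∨ g = e ∨ g = f) :
    ∑ v, deg H v * deg H v = deg H w * deg H w + deg H w + 4 +
      2 * ((univ.filter (fun v => H.Adj w v ∧ v ∈ e)).card + (univ.filter (fun v => H.Adj w v ∧ v ∈ f)).card +
        (univ.filter (fun v => v ∈ e ∧ v ∈ f)).card) := by
  have e1 := add_sum_erase (univ : Finset V) (fun v => deg H v * deg H v) (mem_univ w)
  rw [← e1]
  have hsum : ∑ v ∈ (univ : Finset V).erase w, deg H v * deg H v =
      ∑ v ∈ (univ : Finset V).erase w,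
        ((if H.Adj w v then 1 else 0) + (if v ∈ e then 1 else 0) + (if v ∈ f then 1 else 0) +
          2 * ((if H.Adj w v ∧ v ∈ e then 1 else 0) + (if H.Adj w v ∧ v ∈ f then 1 else 0) +
            (if v ∈ e ∧ v ∈ f then 1 else 0))) := by
    apply sum_congr rfl
    intro v hv
    rw [deg_eq_of_two_off H w e f he hf hwe hwf hef hall v (mem_erase.mp hv).1]
    rw [three_indicator_sq _ _ _ (by split_ifs <;> omega) (by split_ifs <;> omega) (by split_ifs <;> omega)]
    congr 2
    by_cases h1 : H.Adj w v <;> by_cases h2 : v ∈ e <;> by_cases h3 : v ∈ f <;> simp [h1, h2, h3]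
  rw [hsum, sum_add_distrib, sum_add_distrib, sum_add_distrib, ← mul_sum, sum_add_distrib, sum_add_distrib,
    sum_erase_boole_adj, sum_erase_boole_mem H w e he hwe, sum_erase_boole_mem H w f hf hwf,
    sum_erase_boole_adj_mem, sum_erase_boole_adj_mem, sum_erase_boole_mem_mem w e f hwe]
  ring

/-- In a triangle-free graph an edge `e` meets `N(w)` in at most one vertex. -/
theorem card_adj_mem_le_one (H : SimpleGraph V) [DecidableRel H.Adj] (hfree : H.CliqueFree 3) (w : V) (e : Sym2 V)
    (he : e ∈ H.edgeFinset) : (univ.filter (fun v => H.Adj w v ∧ v ∈ e)).card ≤ 1 := by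
  rw [card_le_one]
  intro x hx y hy
  rw [mem_filter] at hx hy
  by_contra hxy
  have hexy : e = s(x, y) := (Sym2.mem_and_mem_iff hxy).mp ⟨hx.2.2, hy.2.2⟩
  have hadjxy : H.Adj x y := by
    rw [hexy] at he
    exact (SimpleGraph.mem_edgeSet H).mp (SimpleGraph.mem_edgeFinset.mp he)
  exact hfree {w, x, y} (SimpleGraph.is3Clique_triple_iff.mpr ⟨hx.2.1, hy.2.1, hadjxy⟩)

/-- Two distinct edges share at most one vertex (as a count). -/
theorem card_mem_mem_le_one (e f : Sym2 V) (hef : e ≠ f) :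
    (univ.filter (fun v => v ∈ e ∧ v ∈ f)).card ≤ 1 := by
  rw [card_le_one]
  intro x hx y hy
  rw [mem_filter] at hx hy
  by_contra hxy
  exact hef (eq_of_mem_mem_of_ne hxy hx.2.1 hy.2.1 hx.2.2 hy.2.2)

/-- **THE TWO EDGES OFF A VERTEX OF DEGREE `s − 2`:** they exist, are distinct, and carry every edge not at `w`. -/
theorem two_off_of_deg (H : SimpleGraph V) [DecidableRel H.Adj] (w : V) (hw : deg H w + 2 = H.edgeFinset.card) :
    ∃ e f, e ∈ H.edgeFinset ∧ f ∈ H.edgeFinset ∧ e ≠ f ∧ w ∉ e ∧ w ∉ f ∧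
      ∀ g ∈ H.edgeFinset, w ∈ g ∨ g = e ∨ g = f := by
  have hsplit := card_filter_add_card_filter_not (s := H.edgeFinset) (p := fun g => w ∈ g)
  have hinc : (H.edgeFinset.filter (fun g => w ∈ g)).card = deg H w := (deg_eq_card_filter_mem H w).symm
  rw [hinc] at hsplit
  have h2 : (H.edgeFinset.filter (fun g => ¬ w ∈ g)).card = 2 := by omega
  obtain ⟨e, f, hef, hS⟩ := card_eq_two.mp h2
  have he : e ∈ H.edgeFinset.filter (fun g => ¬ w ∈ g) := by rw [hS]; exact mem_insert_self _ _
  have hf : f ∈ H.edgeFinset.filter (fun g => ¬ w ∈ g) := by rw [hS]; exact mem_insert_of_mem (mem_singleton_self _)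
  rw [mem_filter] at he hf
  refine ⟨e, f, he.1, hf.1, hef, he.2, hf.2, ?_⟩
  intro g hg
  by_cases hwg : w ∈ g
  · exact Or.inl hwg
  · right
    have : g ∈ H.edgeFinset.filter (fun g => ¬ w ∈ g) := mem_filter.mpr ⟨hg, hwg⟩
    rw [hS, mem_insert, mem_singleton] at this
    exact this

/-- **THE FOURTH-BEST LOCUS OF THE PAIR COUNT:** a triangle-free graph with `s ≥ 8` edges and
`Σ_v d(v)² + 4 (s − 3) = s (s + 1)` has a vertex `w` of degree `s − 2` whose two off-edges `e ≠ f` share a vertex and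
each meet `N(w)` in exactly one vertex. -/
theorem fourth_locus_of_sum_deg_sq (H : SimpleGraph V) [DecidableRel H.Adj] (hfree : H.CliqueFree 3) (s : ℕ)
    (hs : 8 ≤ s) (hm : H.edgeFinset.card = s)
    (hS : ∑ v, deg H v * deg H v + 4 * (s - 3) = s * (s + 1)) :
    ∃ w, deg H w + 2 = s ∧ ∃ e f, e ∈ H.edgeFinset ∧ f ∈ H.edgeFinset ∧ e ≠ f ∧ w ∉ e ∧ w ∉ f ∧
      (∀ g ∈ H.edgeFinset, w ∈ g ∨ g = e ∨ g = f) ∧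
      (univ.filter (fun v => H.Adj w v ∧ v ∈ e)).card = 1 ∧ (univ.filter (fun v => H.Adj w v ∧ v ∈ f)).card = 1 ∧
      (univ.filter (fun v => v ∈ e ∧ v ∈ f)).card = 1 := by
  have hne : (univ : Finset V).Nonempty := by
    obtain ⟨e, he⟩ := card_pos.mp (by omega : 0 < H.edgeFinset.card)
    revert he
    refine Sym2.ind (fun x y _ => ?_) e
    exact ⟨x, mem_univ x⟩
  obtain ⟨w, -, hwmax⟩ := exists_max_image univ (deg H) hne
  have hwle : deg H w ≤ H.edgeFinset.card := by
    rw [deg_eq_degree, ← SimpleGraph.card_incidenceFinset_eq_degree]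
    exact card_le_card (H.incidenceFinset_subset w)
  rcases lt_trichotomy (deg H w + 2) s with hlt | heq | hgt
  · exfalso
    have hΔ : ∀ v, deg H v + 3 ≤ H.edgeFinset.card := fun v => by
      have := hwmax v (mem_univ v)
      omega
    have := sum_deg_sq_le_of_maxdeg3 H hfree (by omega) hΔ
    rw [hm] at this
    omega
  · refine ⟨w, heq, ?_⟩
    obtain ⟨e, f, he, hf, hef, hwe, hwf, hall⟩ := two_off_of_deg H w (by omega)
    have hform := sum_deg_sq_two_off H w e f he hf hwe hwf hef hall
    have c1 := card_adj_mem_le_one H hfree w e he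
    have c2 := card_adj_mem_le_one H hfree w f hf
    have c3 := card_mem_mem_le_one e f hef
    refine ⟨e, f, he, hf, hef, hwe, hwf, hall, ?_⟩
    obtain ⟨d, hd⟩ : ∃ d, deg H w = d := ⟨_, rfl⟩
    rw [hd] at heq hform
    subst heq
    have e1 : (d + 2) * (d + 2 + 1) = d * d + 5 * d + 6 := by ring
    have e2 : d + 2 - 3 = d - 1 := by omega
    rw [e1, e2] at hS
    omega
  · exfalso
    rcases Nat.eq_or_lt_of_le (show s ≤ deg H w + 1 by omega) with heq1 | hlt1
    · -- `d(w) = s − 1`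
      obtain ⟨e, he, hwe⟩ := exists_edge_not_mem H w (by omega)
      have hall := mem_of_ne_of_deg_eq_pred H w (by omega) e he hwe
      by_cases hend : ∀ u ∈ e, ¬ H.Adj w u
      · have := sum_deg_sq_of_star_plus_pair H w (by omega) e he hwe hend hall
        rw [hm] at this
        omega
      · obtain ⟨u, hu, hadj⟩ : ∃ u ∈ e, H.Adj w u := by
          by_contra h
          exact hend (fun u hu hadj => h ⟨u, hu, hadj⟩)
        obtain ⟨v, rfl⟩ := Sym2.mem_iff_exists.mp hu
        have huv : H.Adj u v := (SimpleGraph.mem_edgeSet H).mp (SimpleGraph.mem_edgeFinset.mp he)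
        have hwv : w ≠ v := fun h => hwe (h ▸ Sym2.mem_mk_right u v)
        have hu2 : 2 ≤ deg H u := two_le_deg_of_adj_adj H u w v hwv hadj.symm huv
        have := sum_deg_sq_ge_of_adj H w u (by omega) hadj hu2
        rw [hm] at this
        omega
    · -- `d(w) = s`
      have hwr : deg H w = H.edgeFinset.card := by omega
      have := sum_deg_sq_eq_of_deg_eq_card H w hwr
      rw [hm] at this
      omega

/-- **THE CONVERSE:** a vertex `w` of degree `s − 2` whose two off-edges share a vertex and each meet `N(w)` gives
`Σ_v d(v)² + 4 (s − 3) = s (s + 1)`. -/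
theorem sum_deg_sq_of_fourth_locus (H : SimpleGraph V) [DecidableRel H.Adj] (w : V)
    (hw : deg H w + 2 = H.edgeFinset.card) (e f : Sym2 V) (he : e ∈ H.edgeFinset) (hf : f ∈ H.edgeFinset)
    (hef : e ≠ f) (hwe : w ∉ e) (hwf : w ∉ f) (hall : ∀ g ∈ H.edgeFinset, w ∈ g ∨ g = e ∨ g = f)
    (c1 : (univ.filter (fun v => H.Adj w v ∧ v ∈ e)).card = 1)
    (c2 : (univ.filter (fun v => H.Adj w v ∧ v ∈ f)).card = 1)
    (c3 : (univ.filter (fun v => v ∈ e ∧ v ∈ f)).card = 1) :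
    ∑ v, deg H v * deg H v + 4 * (H.edgeFinset.card - 3) = H.edgeFinset.card * (H.edgeFinset.card + 1) := by
  have hform := sum_deg_sq_two_off H w e f he hf hwe hwf hef hall
  rw [c1, c2, c3] at hform
  have hd1 : 1 ≤ deg H w := by
    obtain ⟨v, hv⟩ := card_pos.mp (by omega : 0 < (univ.filter (fun v => H.Adj w v ∧ v ∈ e)).card)
    unfold deg
    exact card_pos.mpr ⟨v, mem_filter.mpr ⟨mem_univ _, (mem_filter.mp hv).2.1⟩⟩
  obtain ⟨d, hd⟩ : ∃ d, deg H w = d := ⟨_, rfl⟩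
  rw [hd] at hw hform hd1
  rw [← hw, hform]
  have e1 : (d + 2) * (d + 2 + 1) = d * d + 5 * d + 6 := by ring
  have e2 : d + 2 - 3 = d - 1 := by omega
  rw [e1, e2]
  omega

/-- **THE FOURTH-BEST LOCUS OF THE CHERRY TABLE (the bipartite case):** on a cell `(k, a, r)` with `3 ≤ a`, `8 ≤ r`,
`2 a + r ≤ k` (`r + 7 ≤ k` on the row `a = 3`) and `4 (r − 3) < stabGapFull k a r`, every `K₄⁻`-free graph at
`Σ_v d(v)² + r (k − 1 − r) + 4 (r − 3) = m k` is a spanning subgraph of some `K(A, Aᶜ)`, `|A| = a`, whose missing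
pairs are an `(r − 2)`-star at a vertex `w` plus two pairs `e ≠ f` sharing a vertex, each meeting the star's leaves in
exactly one vertex. -/
theorem cherry_fourth_best_locus (k a r : ℕ) (ha3 : 3 ≤ a) (hr8 : 8 ≤ r) (hk : 2 * a + r ≤ k)
    (hk3 : a = 3 → r + 7 ≤ k) (hlt : 4 * (r - 3) < stabGapFull k a r) (D : SimpleGraph (Fin k))
    [DecidableRel D.Adj] (hK : K4mFree D) (hm : D.edgeFinset.card + r = a * (k - a))
    (heq : ∑ v, deg D v * deg D v + r * (k - 1 - r) + 4 * (r - 3) = D.edgeFinset.card * k) :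
    ∃ A : Finset (Fin k), A.card = a ∧ BipSub D A ∧
      ∃ w, deg (missingGraph D A) w + 2 = r ∧ ∃ e f, e ∈ (missingGraph D A).edgeFinset ∧
        f ∈ (missingGraph D A).edgeFinset ∧ e ≠ f ∧ w ∉ e ∧ w ∉ f ∧
        (∀ g ∈ (missingGraph D A).edgeFinset, w ∈ g ∨ g = e ∨ g = f) ∧
        (univ.filter (fun v => (missingGraph D A).Adj w v ∧ v ∈ e)).card = 1 ∧
        (univ.filter (fun v => (missingGraph D A).Adj w v ∧ v ∈ f)).card = 1 ∧
        (univ.filter (fun v => v ∈ e ∧ v ∈ f)).card = 1 := by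
  have hcard : Fintype.card (Fin k) = k := Fintype.card_fin k
  have hbip : ∃ A : Finset (Fin k), A.card = a ∧ BipSub D A := by
    by_contra hnb
    have h := (stab_table_rows_ge_three k a r ha3 hk (by omega) hk3).1 D hK hm hnb
    omega
  obtain ⟨A, hA, hB⟩ := hbip
  refine ⟨A, hA, hB, ?_⟩
  have hH := bipSub_sum_deg_sq_add_disjEdgePairs D A hB a r hA (by rw [hcard]; exact hm) (by rw [hcard]; omega)
  rw [hcard] at hH
  have hr : (missingGraph D A).edgeFinset.card = r := card_edges_missingGraph D A hB a r hA (by rw [hcard]; exact hm)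
  have hid := sum_deg_sq_add_disjEdgePairs (missingGraph D A)
  rw [hr] at hid
  have hS : ∑ v, deg (missingGraph D A) v * deg (missingGraph D A) v + 4 * (r - 3) = r * (r + 1) := by
    omega
  exact fourth_locus_of_sum_deg_sq (missingGraph D A) (cliqueFree_of_bipSub _ A (bipSub_missingGraph D A)) r hr8
    hr hS

end C047

end TriangleCap

end PercRepro
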